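import Mathlib
import Literature.Computability.AlgebraicComplexity.StandardFamilies
import Literature.Computability.AlgebraicComplexity.HessianAtOrigin
import Literature.LinearAlgebra.Matrix.PermanentLaplace

/-!
# Crux `RefutationDegree.BeyondHessianSos` (stmt-ValiantsHypothesis-5643), line `Sketch` —
# stub `stub_borderExpansion` (border slicing at the Mignon–Ressayre point)

Let `y₀ = mrPoint ℂ p` be the Mignon–Ressayre point of size `n = p + 3` (all ones, corner entry
`-(p + 2)`), and let `v` be a matrix vanishing on the first row and column away from the corner,
with corner `a = v (0, 0)` and lower-right block `B` of size `m = p + 2`. If the permanent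
vanishes on the whole line `s • y₀ + v`, then `a = 0` and `per (J + B) = m!`.

Proof: a double Laplace expansion of `per (s • y₀ + v)` along the border gives the polynomial
identity `(a - m s) P(s) + s² P'(s) = 0`, where `P(s) = per (s J + B)` (the sum of the
`(m-1) × (m-1)` sub-permanents of `s J + B` is the derivative of `P`). Comparing coefficients
(`P` has leading coefficient `m!` in degree `m`) forces `a = 0` and then `P = m! s^m`, so
`per (J + B) = P(1) = m!`.
-/

set_option linter.dupNamespace false

noncomputable section

open scoped BigOperators
open MvPolynomial

namespace Summit.ValiantsHypothesis.ValiantsHypothesis.Theorems.RefutationDegreeBeyondHessianSos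

open Literature.Computability.AlgebraicComplexity

/-- Evaluation of a polynomial matrix commutes with the permanent. -/
private theorem permanent_map_eval {R : Type*} [CommRing R] {n : Type*} [Fintype n]
    [DecidableEq n] (Y : Matrix n n (Polynomial R)) (s : R) :
    (Y.map (Polynomial.eval s)).permanent = Polynomial.eval s Y.permanent := by
  simp [Matrix.permanent, Polynomial.eval_finsetSum, Polynomial.eval_prod]

/-- Derivative of the permanent of a polynomial matrix all of whose entries have derivative `1`
(e.g. `X + C b`): it is the sum of all the sub-permanents obtained by deleting one row and one
column (product rule, then Laplace expansion along the differentiated column). -/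
private theorem derivative_permanent_of_derivative_eq_one {R : Type*} [CommRing R] {m : ℕ}
    (Y : Matrix (Fin (m + 1)) (Fin (m + 1)) (Polynomial R))
    (hY : ∀ i j, Polynomial.derivative (Y i j) = 1) :
    Polynomial.derivative Y.permanent =
      ∑ j : Fin (m + 1), ∑ i : Fin (m + 1), (Y.submatrix i.succAbove j.succAbove).permanent := by
  -- Laplace expansion along column `j` of `Y` with column `j` replaced by ones
  have h1 : ∀ j : Fin (m + 1), (Y.updateCol j (fun _ => 1)).permanent =
      ∑ i : Fin (m + 1), (Y.submatrix i.succAbove j.succAbove).permanent := by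
    intro j
    rw [Matrix.permanent_eq_sum_column _ j]
    refine Finset.sum_congr rfl fun i _ => ?_
    rw [Matrix.updateCol_self, one_mul]
    congr 1
    ext r c
    simp only [Matrix.submatrix_apply, Matrix.updateCol_ne (Fin.succAbove_ne j c)]
  -- the product rule, one permutation at a time
  have h2 : ∀ σ : Equiv.Perm (Fin (m + 1)), Polynomial.derivative (∏ i, Y (σ i) i) =
      ∑ j : Fin (m + 1), ∏ i, (Y.updateCol j (fun _ => 1)) (σ i) i := by
    intro σ
    rw [Polynomial.derivative_prod_finset]
    refine Finset.sum_congr rfl fun j _ => ?_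
    rw [hY, mul_one, ← Finset.mul_prod_erase Finset.univ _ (Finset.mem_univ j),
      Matrix.updateCol_self, one_mul]
    refine Finset.prod_congr rfl fun i hi => ?_
    rw [Matrix.updateCol_ne (Finset.ne_of_mem_erase hi)]
  calc Polynomial.derivative Y.permanent
      = ∑ σ : Equiv.Perm (Fin (m + 1)), ∑ j : Fin (m + 1),
          ∏ i, (Y.updateCol j (fun _ => 1)) (σ i) i := by
        rw [Matrix.permanent, Polynomial.derivative_sum]
        exact Finset.sum_congr rfl fun σ _ => h2 σ
    _ = ∑ j : Fin (m + 1), (Y.updateCol j (fun _ => 1)).permanent := by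
        rw [Finset.sum_comm]
        rfl
    _ = _ := Finset.sum_congr rfl fun j _ => h1 j

/-- Double Laplace expansion of the permanent of a bordered matrix whose first row and first
column are constant (`= s`) away from the corner:
`per M = M₀₀ · per M' + s² · Σ_{i,j} per (M' minus row i and column j)`, `M'` the lower-right
block. -/
private theorem permanent_border {R : Type*} [CommRing R] {m : ℕ}
    (M : Matrix (Fin (m + 2)) (Fin (m + 2)) R) (s : R)
    (hrow : ∀ j : Fin (m + 1), M 0 j.succ = s) (hcol : ∀ i : Fin (m + 1), M i.succ 0 = s) :
    M.permanent = M 0 0 * (M.submatrix Fin.succ Fin.succ).permanent +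
      s ^ 2 * ∑ j : Fin (m + 1), ∑ i : Fin (m + 1),
        ((M.submatrix Fin.succ Fin.succ).submatrix i.succAbove j.succAbove).permanent := by
  rw [Matrix.permanent_eq_sum_row_zero, Fin.sum_univ_succ, Fin.succAbove_zero]
  simp only [Finset.mul_sum]
  congr 1
  refine Finset.sum_congr rfl fun j _ => ?_
  rw [hrow, Matrix.permanent_eq_sum_column _ 0]
  simp only [Finset.mul_sum]
  refine Finset.sum_congr rfl fun i _ => ?_
  have h0 : (M.submatrix Fin.succ j.succ.succAbove) i 0 = s := by
    simp only [Matrix.submatrix_apply, Fin.succ_succAbove_zero, hcol]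
  have hsub : (M.submatrix Fin.succ j.succ.succAbove).submatrix i.succAbove Fin.succ =
      (M.submatrix Fin.succ Fin.succ).submatrix i.succAbove j.succAbove := by
    ext r c
    simp only [Matrix.submatrix_apply, Fin.succ_succAbove_succ]
  rw [h0, Fin.succAbove_zero, pow_two, mul_assoc, hsub]

/-- **Stub `stub_borderExpansion`.** Border slicing at the Mignon–Ressayre point: if `v`
vanishes on the first row and the first column away from the corner and the permanent vanishes
identically on the line `s • y₀ + v` (`y₀ = mrPoint ℂ p`, size `p + 3`), then the corner entry
`v (0, 0)` vanishes and the lower-right block `B` of `v` satisfies `per (J + B) = (p + 2)!`. -/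
theorem stub_borderExpansion (p : ℕ) (v : Fin (p + 3) × Fin (p + 3) → ℂ)
    (hrow : ∀ j : Fin (p + 2), v (0, j.succ) = 0) (hcol : ∀ i : Fin (p + 2), v (i.succ, 0) = 0)
    (hper : ∀ s : ℂ, MvPolynomial.eval (s • mrPoint ℂ p + v) (perPoly (Fin (p + 3)) ℂ) = 0) :
    v (0, 0) = 0 ∧
      MvPolynomial.eval (fun ij : Fin (p + 2) × Fin (p + 2) => 1 + v (ij.1.succ, ij.2.succ))
        (perPoly (Fin (p + 2)) ℂ) = (Nat.factorial (p + 2) : ℂ) := by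
  -- notation: the corner `a`, the polynomial block `Y = X J + B`, `P = per Y`, `D = Σ minors`
  set a : ℂ := v (0, 0) with ha_def
  set Y : Matrix (Fin (p + 2)) (Fin (p + 2)) (Polynomial ℂ) :=
    Matrix.of fun i j => Polynomial.X + Polynomial.C (v (i.succ, j.succ)) with hY_def
  set P : Polynomial ℂ := Y.permanent with hP_def
  set D : Polynomial ℂ := ∑ j : Fin (p + 2), ∑ i : Fin (p + 2),
    (Y.submatrix i.succAbove j.succAbove).permanent with hD_def
  -- `D = P'`
  have hD : Polynomial.derivative P = D :=
    derivative_permanent_of_derivative_eq_one Y fun i j => by simp [hY_def]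
  -- the border expansion, evaluated at every `s`
  have hΦ : ∀ s : ℂ, a * P.eval s - ((p : ℂ) + 2) * (s * P.eval s) + s ^ 2 * D.eval s = 0 := by
    intro s
    set M : Matrix (Fin (p + 3)) (Fin (p + 3)) ℂ :=
      Matrix.of fun i j => (s • mrPoint ℂ p + v) (i, j) with hM_def
    have hM : M.permanent = 0 := by rw [hM_def, ← eval_perPoly]; exact hper s
    have hsub : M.submatrix Fin.succ Fin.succ = Y.map (Polynomial.eval s) := by
      ext i j
      simp [hM_def, hY_def, mrPoint_apply, Fin.succ_ne_zero]
    have h00 : M 0 0 = a - ((p : ℂ) + 2) * s := by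
      simp only [hM_def, Matrix.of_apply, Pi.add_apply, Pi.smul_apply, mrPoint_apply, and_self,
        if_true, smul_eq_mul, ha_def]
      ring
    have hrow' : ∀ j : Fin (p + 2), M 0 j.succ = s := fun j => by
      simp [hM_def, mrPoint_apply, Fin.succ_ne_zero, hrow]
    have hcol' : ∀ i : Fin (p + 2), M i.succ 0 = s := fun i => by
      simp [hM_def, mrPoint_apply, Fin.succ_ne_zero, hcol]
    have hPs : (Y.map (Polynomial.eval s)).permanent = P.eval s := permanent_map_eval Y s
    have hDs : ∑ j : Fin (p + 2), ∑ i : Fin (p + 2),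
        ((Y.map (Polynomial.eval s)).submatrix i.succAbove j.succAbove).permanent = D.eval s := by
      simp only [hD_def, Polynomial.eval_finsetSum, Matrix.submatrix_map, permanent_map_eval]
    have key := permanent_border M s hrow' hcol'
    rw [hM, h00, hsub, hPs, hDs] at key
    linear_combination -key
  -- hence the polynomial identity `a P - (p+2) X P + X² P' = 0`
  have hΦ0 : Polynomial.C a * P - Polynomial.C ((p : ℂ) + 2) * (Polynomial.X * P) +
      Polynomial.X ^ 2 * Polynomial.derivative P = 0 := by
    refine Polynomial.funext fun s => ?_
    rw [hD]
    simp only [Polynomial.eval_add, Polynomial.eval_sub, Polynomial.eval_mul, Polynomial.eval_C,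
      Polynomial.eval_X, Polynomial.eval_pow, Polynomial.eval_zero]
    exact hΦ s
  -- coefficient `0`: `a p₀ = 0`
  have h0 : a * P.coeff 0 = 0 := by
    have := congrArg (fun q => Polynomial.coeff q 0) hΦ0
    simpa [Polynomial.coeff_C_mul, Polynomial.coeff_X_pow_mul', Polynomial.mul_coeff_zero] using this
  -- coefficient `k + 1`: `a p_{k+1} - (p + 2) p_k + k p_k = 0`
  have hk : ∀ k : ℕ, a * P.coeff (k + 1) - ((p : ℂ) + 2) * P.coeff k + k * P.coeff k = 0 := by
    intro k
    have := congrArg (fun q => Polynomial.coeff q (k + 1)) hΦ0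
    simp only [Polynomial.coeff_add, Polynomial.coeff_sub, Polynomial.coeff_C_mul,
      Polynomial.coeff_X_mul, Polynomial.coeff_X_pow_mul', Polynomial.coeff_zero] at this
    cases k with
    | zero => simpa using this
    | succ k =>
      rw [if_pos (by omega), show k + 1 + 1 - 2 = k by omega, Polynomial.coeff_derivative] at this
      push_cast
      linear_combination this
  -- the leading coefficient: `p_{p+2} = (p + 2)!`
  have hlead : P.coeff (p + 2) = (Nat.factorial (p + 2) : ℂ) := by
    have hterm : ∀ σ : Equiv.Perm (Fin (p + 2)), (∏ i, Y (σ i) i).coeff (p + 2) = 1 := by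
      intro σ
      have hmon : (∏ i, Y (σ i) i).Monic :=
        Polynomial.monic_prod_of_monic _ _ fun i _ => by
          simp only [hY_def, Matrix.of_apply]
          exact Polynomial.monic_X_add_C _
      have hdeg : (∏ i, Y (σ i) i).natDegree = p + 2 := by
        rw [Polynomial.natDegree_prod_of_monic _ _ fun i _ => by
          simp only [hY_def, Matrix.of_apply]; exact Polynomial.monic_X_add_C _]
        simp [hY_def]
      have h := hmon.coeff_natDegree
      rwa [hdeg] at h
    rw [hP_def, Matrix.permanent, Polynomial.finsetSum_coeff]
    simp only [hterm, Finset.sum_const, Finset.card_univ, Fintype.card_perm, Fintype.card_fin,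
      nsmul_eq_mul, mul_one]
  -- `a = 0`
  have ha : a = 0 := by
    by_contra ha
    have hall : ∀ k : ℕ, P.coeff k = 0 := by
      intro k
      induction k with
      | zero => exact (mul_eq_zero.mp h0).resolve_left ha
      | succ k ih =>
        have := hk k
        rw [ih, mul_zero, mul_zero, sub_zero, add_zero] at this
        exact (mul_eq_zero.mp this).resolve_left ha
    have := hall (p + 2)
    rw [hlead] at this
    exact Nat.cast_ne_zero.mpr (Nat.factorial_ne_zero (p + 2)) this
  -- all other coefficients vanish
  have hzero : ∀ k : ℕ, k ≠ p + 2 → P.coeff k = 0 := by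
    intro k hkne
    have h := hk k
    rw [ha, zero_mul, zero_sub] at h
    have h' : ((k : ℂ) - ((p : ℂ) + 2)) * P.coeff k = 0 := by linear_combination h
    refine (mul_eq_zero.mp h').resolve_left (sub_ne_zero.mpr ?_)
    exact_mod_cast hkne
  -- so `P = (p + 2)! X^{p+2}`
  have hP : P = Polynomial.C (Nat.factorial (p + 2) : ℂ) * Polynomial.X ^ (p + 2) := by
    ext k
    rw [Polynomial.coeff_C_mul_X_pow]
    split_ifs with h
    · rw [h, hlead]
    · exact hzero k h
  refine ⟨ha, ?_⟩
  rw [eval_perPoly]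
  have hmat : (Matrix.of fun i j : Fin (p + 2) => 1 + v (i.succ, j.succ)) =
      Y.map (Polynomial.eval 1) := by
    ext i j
    simp [hY_def]
  rw [hmat, permanent_map_eval, ← hP_def, hP]
  simp
  
end Summit.ValiantsHypothesis.ValiantsHypothesis.Theorems.RefutationDegreeBeyondHessianSos

end
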